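import Mathlib
import Summits.NavierStokesRegularity.NavierStokesRegularity.Theses.FrozenSignCascade
import Summits.NavierStokesRegularity.NavierStokesRegularity.Theorems.FrozenSignCascadeEnvelopeBoundEnstrophy
import Summits.NavierStokesRegularity.NavierStokesRegularity.Theorems.FrozenSignCascadeEnvelopeBoundKatoFourierSide
import HarnessLib

/-!
# Route FrozenSignCascade · crux `EnvelopeBound` (stmt-NavierStokesRegularity-1549): the crux in the
  Kato vocabulary — it holds below `T_max`, and it is exactly "no `PM²` overshoot at a finite `T_max`"

Support file for the crux item stmt-NavierStokesRegularity-1549 (`EnvelopeBound`, rank 2 of route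
`FrozenSignCascade`); lands `--supports` that item (line `registered`, lead c5). Companion of
`FrozenSignCascadeEnvelopeBoundKatoFourierSide` (Fourier-mild solutions below a Kato solution).

**What is proved.**

1. `exists_isTaoSolutionOn_beyond_of_isFourierMild`, `ofReal_lt_katoMaximalTime_of_isFourierMild`
   — a Fourier-mild solution of the Clay datum on `[0, T]`, `T > 0`, forces `T < T_max(ν, u₀)`
   (`Literature.Analysis.FluidPDE.katoMaximalTime`): the restart induction of `NSKatoToClayHolds`
   run along the GIVEN mild solution (weights of the restart data by uniqueness p146654) produces a
   Tao-class, hence Kato, solution strictly beyond `T`.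
2. `envelope_of_isKatoSolutionOn`, `envelope_of_lt_katoMaximalTime` — conversely, at every
   horizon `T₀ < T_max(ν, u₀)` the conclusion of the crux holds for the datum: one constant bounds
   `‖ξ‖² ‖V(t,ξ)‖` along every Fourier-mild solution from it on `[0,T]`, `T ≤ T₀`
   (`Kato.exists_fourierMild_four_of_isKatoSolutionOn` and `Registered.envelope_bounded_of_exists_mild`).
3. `envelope_of_hasGlobalKatoSolution`, `envelopeBound_of_globalKato`,
   `envelopeBound_of_katoMaximalTime_eq_top` — `EnvelopeBound` is implied by "every Clay datum has
   a global Kato solution" (`HasGlobalKatoSolution`, the regularity currency of routes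
   MarginalTypeI / HardyPointSink / AmplitudeIndex / MinimalBlowupRigidity / AxisymmetricExtremality
   and the hypothesis of the PROVED Kato-to-Clay passage `clay_solution_of_hasGlobalKatoSolution_holds`).
4. `envelopeBound_iff_katoFinite` — the NORMAL FORM: `EnvelopeBound` holds iff for every `ν > 0`
   and every Clay datum with FINITE Kato lifespan `T_max(ν,u₀) < ∞` the critical envelope is bounded
   by one constant along all Fourier-mild solutions from the datum (all of which live on `[0,T]`,
   `T < T_max`, by 1). In words: the crux is exactly "no `PM²` overshoot before a Kato blow-up time"
   — the large-data critical a-priori bound recorded as open (grounder g26-21; leads c1–c4); below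
   `T_max` nothing is open, and under global Kato regularity the crux is a corollary.

These are conditional normal forms and regimes: they credit nothing toward closing the item and are
landed as supports (registered sub-goals `stub_katoEnvelopeBelowMaximalTime`,
`stub_katoEnvelopeBoundOfGlobalKato`, `envelopeBound_iff_katoFinite`).

References: T. Kato, Math. Z. 187 (1984), Thms. 1, 4; W. Rusin, V. Šverák, JFA 260 (2011) §3
(`T_max`); P. G. Lemarié-Rieusset, *The Navier–Stokes Problem in the 21st Century* (2016),
Thm. 7.2 (restart, `T_MAX`), Prop. 12.3; J. Leray, Acta Math. 63 (1934) §§19–21.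
-/

noncomputable section

set_option linter.dupNamespace false -- nested layout Summit.<S>.<Sub>, Sub = S (D-0017)

open MeasureTheory Set Function Filter Topology Real Complex FourierTransform InnerProductSpace
open scoped ENNReal NNReal ContDiff FourierTransform ComplexConjugate Laplacian
open Literature.Analysis.FluidPDE Literature.Analysis.FluidPDE.FourierNS

namespace Summit.NavierStokesRegularity.NavierStokesRegularity.Theorems.EnvelopeBound.Kato

/-! ### Continuation of the physical solution along a given Fourier-mild solution -/

-- adapted from Literature/Analysis/FluidPDE/NSKatoToClayHolds.lean
-- (`exists_isTaoSolutionOn_of_hasGlobalKatoSolution'`): same restart induction, the weights of the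
-- restart data being controlled by UNIQUENESS with the given Fourier-mild solution instead of by
-- the Kato solution's splitting.
/-- **A Fourier-mild solution on `[0, T]` carries a Tao-class solution strictly beyond `T`.** Let
`V` be a Fourier-side mild solution on `[0, T]`, `T > 0`, of the Clay datum `u₀`
(`IsFourierMild (4π²ν) 4 0 T V`, `V 0 = fourierData hu hd`). Then for some `T⁺ > T` there are a
Tao-class solution `(u, p)` from `u₀` on `[0, T⁺]` and a Fourier-mild `V⁺` on `[0, T⁺]` from the
same datum synthesising to it. Proof: the restart induction by Fourier–Picard pieces
(`exists_isTaoSolutionOn_fourierPiece`; glue `IsTaoSolutionOn.glue` / `IsFourierMild.glue`), the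
order-`4` weight of every restart datum `V⁺(t')`, `t' ≤ T`, being the uniform-in-time weight of
`V` itself by uniqueness of Fourier-mild solutions (`Registered.stub_mildUnique`, p146654), so that
the pieces have one length `T_P` and the last one overshoots `T`.
[cite: LemarieRieusset2016, Thm. 7.2 (restart of mild solutions)] -/
theorem exists_isTaoSolutionOn_beyond_of_isFourierMild {ν : ℝ} (hν : 0 < ν)
    {u₀ : EuclideanSpace ℝ (Fin 3) → EuclideanSpace ℝ (Fin 3)} (hsm : ContDiff ℝ ∞ u₀)
    (hdiv : NSWave0.IsDivFree u₀) (hdec : HasRapidSpatialDecay u₀)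
    {T : ℝ} (hT : 0 < T) {Vg : ℝ → EuclideanSpace ℝ (Fin 3) → Fin 3 → ℂ}
    (hVg : IsFourierMild (4 * π ^ 2 * ν) 4 0 T Vg) (hVg0 : Vg 0 = fourierData hsm hdec) :
    ∃ T' : ℝ, T < T' ∧
      ∃ (u : ℝ → EuclideanSpace ℝ (Fin 3) → EuclideanSpace ℝ (Fin 3))
        (p : ℝ → EuclideanSpace ℝ (Fin 3) → ℝ) (V : ℝ → EuclideanSpace ℝ (Fin 3) → Fin 3 → ℂ),
        IsTaoSolutionOn T' ν u₀ u p ∧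
        IsFourierMild (4 * π ^ 2 * ν) (Fintype.card (Fin 3) + 1) 0 T' V ∧
        (∀ t ∈ Icc 0 T', u t = synthVel (V t)) ∧ V 0 = fourierData hsm hdec := by
  /- the heat rate, the uniform order-`4` weight of the given mild solution, the piece length -/
  set cF : ℝ := 4 * π ^ 2 * ν with hcF
  have hcF0 : 0 < cF := by positivity
  have hVg' : IsFourierMild cF (Fintype.card (Fin 3) + 1) 0 T Vg :=
    { hc := hVg.hc, hK₀ := by simp, le := hVg.le, cont := hVg.cont, decay := hVg.decay,
      duhamel := hVg.duhamel, divFree := hVg.divFree, conjSymm := hVg.conjSymm }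
  obtain ⟨Aunif, hA⟩ := hVg.decay (Fintype.card (Fin 3) + 1)
  have hAunif0 : 0 ≤ Aunif := (hA 0).nonneg
  set TP : ℝ := picardTime (Fin 3) cF (Fintype.card (Fin 3) + 1) (2 * Aunif) with hTP
  have hTPpos : 0 < TP := picardTime_pos hcF0 _ _ (by positivity)
  set Tw : ℝ := T + TP with hTw
  have hTTw : T < Tw := by rw [hTw]; linarith
  have hTw0 : 0 < Tw := hT.trans hTTw
  /- the initial Fourier datum -/
  set a₀ : EuclideanSpace ℝ (Fin 3) → Fin 3 → ℂ := fourierData hsm hdec with ha₀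
  have hA₀ : HasDecay (Fintype.card (Fin 3) + 1) Aunif a₀ := by rw [← hVg0]; exact hA 0
  have hdiv' : ∀ ξ : EuclideanSpace ℝ (Fin 3), ∑ l, (ξ l : ℂ) * a₀ ξ l = 0 :=
    sum_mul_fourierData hsm hdec hdiv
  have hconj₀ : ∀ ξ l, a₀ (-ξ) l = conj (a₀ ξ l) := fourierData_conj_symm hsm hdec
  have hsynth₀ : synthVel a₀ = u₀ := by
    funext x
    ext l
    rw [synthVel_apply, show (fun ξ => a₀ ξ l) = fun ξ => fourierData hsm hdec ξ l from rfl,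
      fourier_fourierData hsm hdec l]
    simp
  /- the state of the induction -/
  set State : ℝ → (ℝ → EuclideanSpace ℝ (Fin 3) → EuclideanSpace ℝ (Fin 3)) →
      (ℝ → EuclideanSpace ℝ (Fin 3) → ℝ) → (ℝ → EuclideanSpace ℝ (Fin 3) → Fin 3 → ℂ) → Prop :=
    fun F u p V => IsTaoSolutionOn F ν u₀ u p ∧
      IsFourierMild cF (Fintype.card (Fin 3) + 1) 0 F V ∧
      (∀ t ∈ Icc 0 F, u t = synthVel (V t)) ∧ V 0 = a₀ with hState
  /- weights of a state on `[0, F]`, `F ≤ T`: by uniqueness it is the given mild solution -/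
  have hbounds : ∀ ⦃F : ℝ⦄ ⦃u : ℝ → EuclideanSpace ℝ (Fin 3) → EuclideanSpace ℝ (Fin 3)⦄
      ⦃p : ℝ → EuclideanSpace ℝ (Fin 3) → ℝ⦄ ⦃V : ℝ → EuclideanSpace ℝ (Fin 3) → Fin 3 → ℂ⦄,
      0 < F → F ≤ T → State F u p V →
        ∀ t' ∈ Icc 0 F, HasDecay (Fintype.card (Fin 3) + 1) Aunif (V t') := by
    intro F u p V _hF hFT hS t' ht'
    obtain ⟨-, hV, -, hV0⟩ := hS
    have heq : V t' = Vg t' :=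
      Registered.stub_mildUnique cF (Fintype.card (Fin 3) + 1) 0 F T V Vg hV hVg'
        (hV0.trans hVg0.symm) t' ht'.1 ht'.2 (ht'.2.trans hFT)
    rw [heq]
    exact hA t'
  /- the restart step -/
  have hstep : ∀ ⦃F : ℝ⦄ ⦃u : ℝ → EuclideanSpace ℝ (Fin 3) → EuclideanSpace ℝ (Fin 3)⦄
      ⦃p : ℝ → EuclideanSpace ℝ (Fin 3) → ℝ⦄ ⦃V : ℝ → EuclideanSpace ℝ (Fin 3) → Fin 3 → ℂ⦄,
      0 < F → F ≤ T → State F u p V →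
      ∃ (F' : ℝ) (u' : ℝ → EuclideanSpace ℝ (Fin 3) → EuclideanSpace ℝ (Fin 3))
        (p' : ℝ → EuclideanSpace ℝ (Fin 3) → ℝ) (V' : ℝ → EuclideanSpace ℝ (Fin 3) → Fin 3 → ℂ),
        (Tw ≤ F' ∨ F + TP / 2 ≤ F') ∧ F' ≤ Tw ∧ 0 < F' ∧ State F' u' p' V' := by
    intro F u p V hF hFT hS
    have hFw : F ≤ Tw := hFT.trans hTTw.le
    have hdecay := hbounds hF hFT hS
    obtain ⟨h, hV, hsyn, hV0⟩ := hS
    set t' : ℝ := max (F / 2) (F - TP / 4) with ht'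
    have ht'0 : 0 ≤ t' := le_max_of_le_left (by linarith)
    have ht'F : t' < F := max_lt (by linarith) (by linarith)
    have hFt' : F ≤ t' + TP := by linarith [le_max_right (F / 2) (F - TP / 4)]
    have ht'I : t' ∈ Icc 0 F := ⟨ht'0, ht'F.le⟩
    -- the restart piece from the Fourier-side state `V t'`
    have hdecAll : ∀ K : ℕ, ∃ B, HasDecay K B (V t') := fun K => by
      obtain ⟨B, hB⟩ := hV.decay K
      exact ⟨B, hB t'⟩
    obtain ⟨v, q, W, hv, hW, hvsyn, hW0⟩ := exists_isTaoSolutionOn_fourierPiece hν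
      (hV.continuous_slice t') hdecAll (hdecay t' ht'I) (hV.divFree t') (hV.conjSymm t')
    rw [← hcF, ← hTP] at hv hW
    have hvt' : synthVel (V t') = u t' := (hsyn t' ht'I).symm
    rw [hvt'] at hv
    -- the physical glue
    have hglue := h.glue hv hν hTPpos ht'0 ht'F hFt'
    -- the agreement on the overlap
    have hagree : ∀ s ∈ Ico 0 (min (F - t') TP), u (s + t') = v s :=
      (h.translate ht'0 ht'F).eq_of_isTaoSolutionOn hv hν (by linarith) hTPpos
    -- the Fourier glue
    have hW' : IsFourierMild cF (Fintype.card (Fin 3) + 1) t' (t' + TP) (fun t => W (t - t')) := by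
      have := hW.translate t'
      simpa only [zero_add, add_comm TP t'] using this
    have hVt' : IsFourierMild cF (Fintype.card (Fin 3) + 1) 0 t' V := hV.mono le_rfl ht'0 ht'F.le
    have hjunction : V t' = (fun t => W (t - t')) t' := by simp only [sub_self, hW0]
    have hGlueF := hVt'.glue hW' hjunction
    set F' : ℝ := min (t' + TP) Tw with hF'
    have hF'pos : 0 < F' := lt_min (by linarith) hTw0
    have hF'le : F' ≤ t' + TP := min_le_left _ _
    refine ⟨F', (fun t => if t < F then u t else v (t - t')),
      (fun t => if t < F then p t else q (t - t')), (fun t => if t ≤ t' then V t else W (t - t')),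
      ?_, min_le_right _ _, hF'pos, ?_, ?_, ?_, ?_⟩
    · by_cases hcase : t' + TP ≤ Tw
      · right; rw [hF', min_eq_left hcase]; linarith [le_max_right (F / 2) (F - TP / 4)]
      · left; rw [hF', min_eq_right (le_of_not_ge hcase)]
    · exact hglue.mono hF'pos hF'le
    · exact hGlueF.mono le_rfl hF'pos.le hF'le
    · -- synthesis at every time of `[0, F']`
      intro t ht
      by_cases htt' : t ≤ t'
      · have htF : t < F := lt_of_le_of_lt htt' ht'F
        simp only [if_pos htF, if_pos htt']
        exact hsyn t ⟨ht.1, htF.le⟩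
      · have hgt : t' < t := not_le.1 htt'
        simp only [if_neg htt']
        by_cases htF : t < F
        · simp only [if_pos htF]
          have hs : t - t' ∈ Ico 0 (min (F - t') TP) :=
            ⟨by linarith, lt_min (by linarith) (by linarith [ht.2])⟩
          have := hagree (t - t') hs
          rw [sub_add_cancel] at this
          rw [this, hvsyn]
        · simp only [if_neg htF]
          exact hvsyn (t - t')
    · -- the initial Fourier datum is unchanged
      show (if (0 : ℝ) ≤ t' then V 0 else W (0 - t')) = a₀
      rw [if_pos ht'0, hV0]
  /- the first state, from the Schwartz datum -/
  have hbase : ∃ (F : ℝ) (u : ℝ → EuclideanSpace ℝ (Fin 3) → EuclideanSpace ℝ (Fin 3))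
      (p : ℝ → EuclideanSpace ℝ (Fin 3) → ℝ) (V : ℝ → EuclideanSpace ℝ (Fin 3) → Fin 3 → ℂ),
      0 < F ∧ F ≤ Tw ∧ State F u p V := by
    obtain ⟨u, p, V, hu, hV, hsyn, hV0⟩ := exists_isTaoSolutionOn_fourierPiece hν
      (continuous_fourierData hsm hdec) (hasDecay_fourierData hsm hdec) hA₀ hdiv' hconj₀
    rw [hsynth₀] at hu
    set T₀ : ℝ := picardTime (Fin 3) (4 * π ^ 2 * ν) (Fintype.card (Fin 3) + 1) (2 * Aunif) with hT₀
    have hT₀pos : 0 < T₀ := picardTime_pos hcF0 _ _ (by positivity)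
    set F₀ : ℝ := min T₀ Tw with hF₀
    have hF₀pos : 0 < F₀ := lt_min hT₀pos hTw0
    refine ⟨F₀, u, p, V, hF₀pos, min_le_right _ _, ?_, ?_, ?_, hV0⟩
    · exact hu.mono hF₀pos (min_le_left _ _)
    · exact hV.mono le_rfl hF₀pos.le (min_le_left _ _)
    · exact fun t _ => hsyn t
  /- the induction -/
  have hiter : ∀ k : ℕ, ∃ (F : ℝ) (u : ℝ → EuclideanSpace ℝ (Fin 3) → EuclideanSpace ℝ (Fin 3))
      (p : ℝ → EuclideanSpace ℝ (Fin 3) → ℝ) (V : ℝ → EuclideanSpace ℝ (Fin 3) → Fin 3 → ℂ),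
      0 < F ∧ F ≤ Tw ∧ State F u p V ∧ (T < F ∨ (k : ℝ) * (TP / 2) ≤ F) := by
    intro k
    induction k with
    | zero =>
      obtain ⟨F, u, p, V, hF, hFw, hS⟩ := hbase
      exact ⟨F, u, p, V, hF, hFw, hS, Or.inr (by simpa using hF.le)⟩
    | succ k ih =>
      obtain ⟨F, u, p, V, hF, hFw, hS, halt⟩ := ih
      rcases lt_or_ge T F with hdone | hle
      · exact ⟨F, u, p, V, hF, hFw, hS, Or.inl hdone⟩
      · obtain ⟨F', u', p', V', hprog, hF'w, hF'pos, hS'⟩ := hstep hF hle hS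
        refine ⟨F', u', p', V', hF'pos, hF'w, hS', ?_⟩
        rcases hprog with hTw' | hadv
        · exact Or.inl (hTTw.trans_le hTw')
        · rcases halt with hd | hk
          · exact absurd hd (not_lt.2 hle)
          · right
            push_cast
            linarith
  obtain ⟨k, hk⟩ := exists_nat_gt (Tw / (TP / 2))
  obtain ⟨F, u, p, V, hF, hFw, hS, halt⟩ := hiter k
  have hTF : T < F := by
    rcases halt with hd | hk'
    · exact hd
    · exfalso
      have h2 : Tw < (k : ℝ) * (TP / 2) := by rwa [div_lt_iff₀ (by positivity)] at hk
      linarith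
  exact ⟨F, hTF, u, p, V, hS.1, hS.2.1, hS.2.2.1, hS.2.2.2⟩


/-- A Tao-class solution on `[0, T]` is a Kato solution on `[0, T)` (it is mild in duality form,
`IsTaoSolutionOn.isMildNSSolutionOn`, lies in `C([0,T]; L³)`, `IsTaoSolutionOn.continuousInLpOn_three`,
attains the datum and is measurable). [cite: Kato1984MathZ, Thm. 1] -/
theorem isKatoSolutionOn_of_isTaoSolutionOn {T ν : ℝ}
    {u₀ : EuclideanSpace ℝ (Fin 3) → EuclideanSpace ℝ (Fin 3)}
    {u : ℝ → EuclideanSpace ℝ (Fin 3) → EuclideanSpace ℝ (Fin 3)}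
    {p : ℝ → EuclideanSpace ℝ (Fin 3) → ℝ} (h : IsTaoSolutionOn T ν u₀ u p) (hν : 0 < ν) :
    IsKatoSolutionOn T ν u₀ u :=
  ⟨(h.isMildNSSolutionOn hν).mono Ico_subset_Icc_self,
    h.continuousInLpOn_three.mono Ico_subset_Icc_self, h.initial, h.aestronglyMeasurable_uncurry⟩

/-- **Fourier-mild solutions live strictly before `T_max`.** If the Clay datum admits a
Fourier-side mild solution on `[0, T]`, `T > 0`, then `T < T_max(ν, u₀)` in `[0, ∞]`.
[cite: RusinSverak2011, §3 p. 5 (T_max)] -/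
theorem ofReal_lt_katoMaximalTime_of_isFourierMild {ν : ℝ} (hν : 0 < ν)
    {u₀ : EuclideanSpace ℝ (Fin 3) → EuclideanSpace ℝ (Fin 3)} (hu : ContDiff ℝ (⊤ : ℕ∞) u₀)
    (hd : HasRapidSpatialDecay u₀) (hdiv : NSWave0.IsDivFree u₀) {T : ℝ} (hT : 0 < T)
    {V : ℝ → EuclideanSpace ℝ (Fin 3) → Fin 3 → ℂ}
    (hV : IsFourierMild (4 * Real.pi ^ 2 * ν) 4 0 T V) (hV0 : V 0 = fourierData hu hd) :
    ENNReal.ofReal T < katoMaximalTime ν u₀ := by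
  obtain ⟨T', hTT', u, p, -, hup, -, -, -⟩ :=
    exists_isTaoSolutionOn_beyond_of_isFourierMild hν hu hdiv hd hT hV hV0
  exact ((ENNReal.ofReal_lt_ofReal_iff').2 ⟨hTT', hT.trans hTT'⟩).trans_le
    (isKatoSolutionOn_of_isTaoSolutionOn hup hν).ofReal_le_katoMaximalTime

/-! ### The envelope below the Kato maximal time -/

/-- **The crux's conclusion at every horizon strictly inside a Kato solution's lifespan.** If a
Kato solution from the Clay datum `u₀` lives on `[0, T')` and `0 < T₀ < T'`, then one constant
bounds the critical envelope `‖ξ‖² ‖V(t,ξ)‖` along every Fourier-mild solution from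
`fourierData hu hd` on `[0, T]`, `T ≤ T₀` (Fourier-mild existence up to `T₀`,
`exists_fourierMild_four_of_isKatoSolutionOn`, and uniqueness,
`Registered.envelope_bounded_of_exists_mild`). [cite: Kato1984MathZ, Thm. 1] -/
theorem envelope_of_isKatoSolutionOn {ν : ℝ} (hν : 0 < ν)
    {u₀ : EuclideanSpace ℝ (Fin 3) → EuclideanSpace ℝ (Fin 3)} (hu : ContDiff ℝ (⊤ : ℕ∞) u₀)
    (hd : HasRapidSpatialDecay u₀) (hdiv : NSWave0.IsDivFree u₀)
    {T' : ℝ} {w : ℝ → EuclideanSpace ℝ (Fin 3) → EuclideanSpace ℝ (Fin 3)}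
    (hw : IsKatoSolutionOn T' ν u₀ w) {T₀ : ℝ} (hT₀ : 0 < T₀) (hT₀T' : T₀ < T') :
    ∃ C : ℝ, ∀ T : ℝ, T ≤ T₀ → ∀ V : ℝ → EuclideanSpace ℝ (Fin 3) → Fin 3 → ℂ,
      IsFourierMild (4 * Real.pi ^ 2 * ν) 4 0 T V → V 0 = fourierData hu hd →
      ∀ t ∈ Set.Icc 0 T, ∀ ξ : EuclideanSpace ℝ (Fin 3), ‖ξ‖ ^ 2 * ‖V t ξ‖ ≤ C :=
  Registered.envelope_bounded_of_exists_mild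
    (exists_fourierMild_four_of_isKatoSolutionOn hν hu hdiv hd hw hT₀ hT₀T')

/-- **The crux's conclusion at every horizon below `T_max`.** If `T₀ < T_max(ν, u₀)`
(`katoMaximalTime`, compared in `[0, ∞]`), the envelope bound of `EnvelopeBound` holds for the Clay
datum `u₀` at the horizon `T₀`. Hence the crux's open content lies entirely on data with finite Kato
lifespan `T_max ≤ T₀`. [cite: RusinSverak2011, §3 p. 5 (T_max)] -/
theorem envelope_of_lt_katoMaximalTime {ν : ℝ} (hν : 0 < ν)
    {u₀ : EuclideanSpace ℝ (Fin 3) → EuclideanSpace ℝ (Fin 3)} (hu : ContDiff ℝ (⊤ : ℕ∞) u₀)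
    (hd : HasRapidSpatialDecay u₀) (hdiv : NSWave0.IsDivFree u₀) {T₀ : ℝ} (hT₀ : 0 < T₀)
    (hlt : ENNReal.ofReal T₀ < katoMaximalTime ν u₀) :
    ∃ C : ℝ, ∀ T : ℝ, T ≤ T₀ → ∀ V : ℝ → EuclideanSpace ℝ (Fin 3) → Fin 3 → ℂ,
      IsFourierMild (4 * Real.pi ^ 2 * ν) 4 0 T V → V 0 = fourierData hu hd →
      ∀ t ∈ Set.Icc 0 T, ∀ ξ : EuclideanSpace ℝ (Fin 3), ‖ξ‖ ^ 2 * ‖V t ξ‖ ≤ C := by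
  obtain ⟨T', hT', w, hw⟩ := exists_isKatoSolutionOn_of_lt_katoMaximalTime hlt
  have hT₀T' : T₀ < T' := (ENNReal.ofReal_lt_ofReal_iff'.1 hT').1
  exact envelope_of_isKatoSolutionOn hν hu hd hdiv hw hT₀ hT₀T'

/-- **Global Kato solution ⇒ the envelope bound at every horizon** (per datum).
[cite: Kato1984MathZ, Thm. 4] -/
theorem envelope_of_hasGlobalKatoSolution {ν : ℝ} (hν : 0 < ν)
    {u₀ : EuclideanSpace ℝ (Fin 3) → EuclideanSpace ℝ (Fin 3)} (hu : ContDiff ℝ (⊤ : ℕ∞) u₀)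
    (hd : HasRapidSpatialDecay u₀) (hdiv : NSWave0.IsDivFree u₀)
    (hK : HasGlobalKatoSolution ν u₀) {T₀ : ℝ} (hT₀ : 0 < T₀) :
    ∃ C : ℝ, ∀ T : ℝ, T ≤ T₀ → ∀ V : ℝ → EuclideanSpace ℝ (Fin 3) → Fin 3 → ℂ,
      IsFourierMild (4 * Real.pi ^ 2 * ν) 4 0 T V → V 0 = fourierData hu hd →
      ∀ t ∈ Set.Icc 0 T, ∀ ξ : EuclideanSpace ℝ (Fin 3), ‖ξ‖ ^ 2 * ‖V t ξ‖ ≤ C :=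
  Registered.envelope_bounded_of_exists_mild
    (exists_fourierMild_of_hasGlobalKatoSolution hν hu hdiv hd hK hT₀)

/-! ### The crux from global Kato regularity -/

/-- **`EnvelopeBound` from global Kato regularity of Clay data.** If every smooth, divergence-free,
rapidly decaying datum has a global Kato solution for every `ν > 0` (global regularity in Kato's
`C([0,∞); L³)` class — the hypothesis under which `clay_solution_of_hasGlobalKatoSolution_holds`
yields the Clay conclusion), then the crux `EnvelopeBound` of route `FrozenSignCascade` holds.
The crux is therefore at most as strong as global Kato regularity. [cite: Kato1984MathZ, Thm. 4] -/
theorem envelopeBound_of_globalKato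
    (hGK : ∀ ν : ℝ, 0 < ν → ∀ u₀ : EuclideanSpace ℝ (Fin 3) → EuclideanSpace ℝ (Fin 3),
      ContDiff ℝ (⊤ : ℕ∞) u₀ → NSWave0.IsDivFree u₀ → HasRapidSpatialDecay u₀ →
      HasGlobalKatoSolution ν u₀) :
    Theses.FrozenSignCascade.EnvelopeBound := by
  intro ν hν u₀ hu hd hdiv T₀ hT₀
  exact envelope_of_hasGlobalKatoSolution hν hu hd hdiv (hGK ν hν u₀ hu hdiv hd) hT₀

/-- **`EnvelopeBound` from `T_max = ∞` for all Clay data** (the same hypothesis phrased by the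
Kato maximal time). [cite: RusinSverak2011, §3 p. 5 (T_max)] -/
theorem envelopeBound_of_katoMaximalTime_eq_top
    (hT : ∀ ν : ℝ, 0 < ν → ∀ u₀ : EuclideanSpace ℝ (Fin 3) → EuclideanSpace ℝ (Fin 3),
      ContDiff ℝ (⊤ : ℕ∞) u₀ → NSWave0.IsDivFree u₀ → HasRapidSpatialDecay u₀ →
      katoMaximalTime ν u₀ = ⊤) :
    Theses.FrozenSignCascade.EnvelopeBound := by
  intro ν hν u₀ hu hd hdiv T₀ hT₀
  exact envelope_of_lt_katoMaximalTime hν hu hd hdiv hT₀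
    (by rw [hT ν hν u₀ hu hdiv hd]; exact ENNReal.ofReal_lt_top)

/-! ### The normal form: no `PM²` overshoot before a finite Kato maximal time -/

/-- **`EnvelopeBound` ⇔ no `PM²` overshoot before a finite Kato blow-up time.** The crux holds if
and only if, for every `ν > 0` and every Clay datum whose Kato maximal time `T_max(ν,u₀)` is FINITE,
one constant bounds the critical envelope `‖ξ‖² ‖V(t,ξ)‖` along all Fourier-mild solutions from
the datum (no restriction on their length `T`: they all satisfy `T < T_max`,
`ofReal_lt_katoMaximalTime_of_isFourierMild`). (`→`: apply the crux at the horizon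
`T_max.toReal + 1`; `←`: below `T_max` use `envelope_of_lt_katoMaximalTime`, otherwise `T_max` is
finite.) Registered sub-goal `envelopeBound_iff_katoFinite` of stmt-NavierStokesRegularity-1549.
[cite: RusinSverak2011, §3 p. 5 (T_max)] -/
theorem envelopeBound_iff_katoFinite : Summit.NavierStokesRegularity.NavierStokesRegularity.Theses.FrozenSignCascade.EnvelopeBound ↔ ∀ ν : ℝ, 0 < ν → ∀ (u₀ : EuclideanSpace ℝ (Fin 3) → EuclideanSpace ℝ (Fin 3)) (hu : ContDiff ℝ (⊤ : ℕ∞) u₀) (hd : Literature.Analysis.FluidPDE.HasRapidSpatialDecay u₀), Literature.Analysis.FluidPDE.NSWave0.IsDivFree u₀ → Literature.Analysis.FluidPDE.katoMaximalTime ν u₀ < ⊤ → ∃ C : ℝ, ∀ (T : ℝ) (V : ℝ → EuclideanSpace ℝ (Fin 3) → Fin 3 → ℂ), Literature.Analysis.FluidPDE.FourierNS.IsFourierMild (4 * Real.pi ^ 2 * ν) 4 0 T V → V 0 = Literature.Analysis.FluidPDE.FourierNS.fourierData hu hd → ∀ t ∈ Set.Icc 0 T, ∀ ξ : EuclideanSpace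 ℝ (Fin 3), ‖ξ‖ ^ 2 * ‖V t ξ‖ ≤ C := by
  constructor
  · intro hA ν hν u₀ hu hd hdiv hfin
    have h0 : 0 ≤ (katoMaximalTime ν u₀).toReal := ENNReal.toReal_nonneg
    obtain ⟨C, hC⟩ := hA ν hν u₀ hu hd hdiv ((katoMaximalTime ν u₀).toReal + 1) (by linarith)
    refine ⟨C, fun T V hV hV0 t ht ξ => ?_⟩
    rcases le_or_gt T ((katoMaximalTime ν u₀).toReal + 1) with hle | hlt
    · exact hC T hle V hV hV0 t ht ξ
    · exfalso
      have hTpos : 0 < T := by linarith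
      have h1 := ofReal_lt_katoMaximalTime_of_isFourierMild hν hu hd hdiv hTpos hV hV0
      rw [← ENNReal.ofReal_toReal hfin.ne, ENNReal.ofReal_lt_ofReal_iff'] at h1
      linarith [h1.1]
  · intro h ν hν u₀ hu hd hdiv T₀ hT₀
    by_cases hlt : ENNReal.ofReal T₀ < katoMaximalTime ν u₀
    · exact envelope_of_lt_katoMaximalTime hν hu hd hdiv hT₀ hlt
    · have hfin : katoMaximalTime ν u₀ < ⊤ := (not_lt.1 hlt).trans_lt ENNReal.ofReal_lt_top
      obtain ⟨C, hC⟩ := h ν hν u₀ hu hd hdiv hfin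
      exact ⟨C, fun T _ V hV hV0 t ht ξ => hC T V hV hV0 t ht ξ⟩

/-! ### Registered forms -/

/-- **Registered sub-goal `stub_katoEnvelopeBelowMaximalTime`** (crux stmt-NavierStokesRegularity-1549,
line `registered`, lead c5): the crux's envelope bound at every horizon strictly below the Kato
maximal time — `envelope_of_lt_katoMaximalTime` in the closed `∀`-form recorded on the ledger.
[cite: RusinSverak2011, §3 p. 5 (T_max)] -/
theorem stub_katoEnvelopeBelowMaximalTime : ∀ ν : ℝ, 0 < ν → ∀ (u₀ : EuclideanSpace ℝ (Fin 3) → EuclideanSpace ℝ (Fin 3)) (hu : ContDiff ℝ (⊤ : ℕ∞) u₀) (hd : Literature.Analysis.FluidPDE.HasRapidSpatialDecay u₀), Literature.Analysis.FluidPDE.NSWave0.IsDivFree u₀ → ∀ T₀ : ℝ, 0 < T₀ → ENNReal.ofReal T₀ < Literature.Analysis.FluidPDE.katoMaximalTime ν u₀ → ∃ C : ℝ, ∀ T : ℝ, T ≤ T₀ → ∀ V : ℝ → EuclideanSpace ℝ (Fin 3) → Fin 3 → ℂ, Literature.Analysis.FluidPDE.FourierNS.IsFourierMild (4 * Real.pi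 ^ 2 * ν) 4 0 T V → V 0 = Literature.Analysis.FluidPDE.FourierNS.fourierData hu hd → ∀ t ∈ Set.Icc 0 T, ∀ ξ : EuclideanSpace ℝ (Fin 3), ‖ξ‖ ^ 2 * ‖V t ξ‖ ≤ C :=
  fun _ hν _ hu hd hdiv _ hT₀ hlt => envelope_of_lt_katoMaximalTime hν hu hd hdiv hT₀ hlt

/-- **Registered sub-goal `stub_katoEnvelopeBoundOfGlobalKato`** (crux stmt-NavierStokesRegularity-1549,
line `registered`, lead c5): `EnvelopeBound` from global Kato regularity of Clay data —
`envelopeBound_of_globalKato` in the form recorded on the ledger. [cite: Kato1984MathZ, Thm. 4] -/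
theorem stub_katoEnvelopeBoundOfGlobalKato : (∀ ν : ℝ, 0 < ν → ∀ u₀ : EuclideanSpace ℝ (Fin 3) → EuclideanSpace ℝ (Fin 3), ContDiff ℝ (⊤ : ℕ∞) u₀ → Literature.Analysis.FluidPDE.NSWave0.IsDivFree u₀ → Literature.Analysis.FluidPDE.HasRapidSpatialDecay u₀ → Literature.Analysis.FluidPDE.HasGlobalKatoSolution ν u₀) → Summit.NavierStokesRegularity.NavierStokesRegularity.Theses.FrozenSignCascade.EnvelopeBound :=
  envelopeBound_of_globalKato

end Summit.NavierStokesRegularity.NavierStokesRegularity.Theorems.EnvelopeBound.Kato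

end
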